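import Mathlib
import HarnessLib
import Summits.HubbardSuperconductivity.HubbardSuperconductivity.Theorems.ComplexGFFStiffnessDefs

/-!
# Crux `HypACumulant`, line `gnv` — the closing bracket: a representation
# `pertZ = c · ∫ (1 + R) dμ` with `c ≠ 0`, `μ` a probability measure and `∫ ‖R‖ dμ ≤ ½` forces
# `pertZ ≠ 0` (ABKM19 Ch. 4 / Thm 11.1, display (11.4): `∫ |K_N| dμ_{N+1} ≤ ½`)

Route `route-HubbardSuperconductivity-ComplexGFFStiffness`, crux item stmt-HubbardSuperconductivity-19154,
research stub `stub_gnvOfFrd : TorusFRD 4 → GNV`.  The renormalisation-group representation of the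
perturbed partition function that the line `gnv` is building ends (ABKM19 Thm 11.1) in
`𝒵_N(𝒦) = e^{L^{Nd} e_N} · (Z^{(q)}/Z^{(0)}) · ∫ (1 + K_N) dμ^{(q)}_{N+1}` with the final activity
exponentially small, `∫ |K_N| dμ ≤ ½`.  For the COMPLEX `ι`-admissible class the scalar prefactor is
still non-zero and `K_N` complex-valued; non-vanishing then follows from the elementary estimate
recorded here: `‖∫ (1 + R) dμ‖ ≥ 1 − ∫ ‖R‖ dμ ≥ ½`.  This is the last step of the composition
`(front end) pertZ_eq_mul_integral_greenMat ∘ (middle, open) ∘ RGFlow.exists_isTrajectory_initial_eq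
∘ (this file) ⇒ GNV`.

## Contents (all proved; no definition, no named fact)
* `norm_integral_one_add_ge` — `1 − ∫‖R‖ ≤ ‖∫ (1 + R) dμ‖` for a probability measure;
* `integral_one_add_ne_zero` — `∫‖R‖ < 1 ⇒ ∫ (1 + R) dμ ≠ 0`;
* **`ne_zero_of_representation`** — `z = c · ∫ (1 + R) dμ`, `c ≠ 0`, `∫ ‖R‖ ≤ ½` ⇒ `z ≠ 0`.

## References
* S. Adams, S. Buchholz, R. Kotecký, S. Müller, arXiv:1910.13564, Thm 11.1 (representation and the
  bound `∫ |K_N| dμ_{N+1} ≤ ½`), Ch. 4 (explanation) [AdamsBuchholzKoteckyMuller2019].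
-/

noncomputable section

-- `Summit.<Summit>.<Problem>`: single-conjunct summit, the duplicate component is mandated (D-0017).
set_option linter.dupNamespace false

namespace Summit.HubbardSuperconductivity.HubbardSuperconductivity.Theorems.ComplexGFF

open MeasureTheory

variable {Ω : Type*} [MeasurableSpace Ω] {μ : Measure Ω} [IsProbabilityMeasure μ]

/-- **`‖∫ (1 + R) dμ‖ ≥ 1 − ∫ ‖R‖ dμ`** for a probability measure `μ` and integrable complex `R`. -/
theorem norm_integral_one_add_ge {R : Ω → ℂ} (hR : Integrable R μ) :
    1 - ∫ ω, ‖R ω‖ ∂μ ≤ ‖∫ ω, (1 + R ω) ∂μ‖ := by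
  rw [integral_add (integrable_const _) hR, integral_const, probReal_univ, one_smul]
  have h1 : ‖∫ ω, R ω ∂μ‖ ≤ ∫ ω, ‖R ω‖ ∂μ := norm_integral_le_integral_norm _
  have h2 : ‖(1 : ℂ)‖ - ‖∫ ω, R ω ∂μ‖ ≤ ‖(1 : ℂ) + ∫ ω, R ω ∂μ‖ := by
    have := norm_sub_norm_le (1 : ℂ) (-(∫ ω, R ω ∂μ))
    rw [norm_neg, sub_neg_eq_add] at this
    exact this
  rw [norm_one] at h2
  linarith

/-- If `∫ ‖R‖ dμ < 1` then `∫ (1 + R) dμ ≠ 0`. -/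
theorem integral_one_add_ne_zero {R : Ω → ℂ} (hR : Integrable R μ)
    (hsmall : ∫ ω, ‖R ω‖ ∂μ < 1) : ∫ ω, (1 + R ω) ∂μ ≠ 0 := by
  intro h
  have := norm_integral_one_add_ge (μ := μ) hR
  rw [h, norm_zero] at this
  linarith

/-- **The closing bracket of the line `gnv`.**  If a complex number `z` (the perturbed partition
function `pertZ n K`) is represented as `z = c · ∫ (1 + R) dμ` with a non-zero scalar `c` (in
ABKM19 Thm 11.1: `e^{L^{Nd} e_N} Z^{(q)}/Z^{(0)}`, times `Z_0` here), a probability measure `μ`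
(`μ^{(q)}_{N+1}`) and an integrable final activity `R` (`K_N(Λ, ·)`) with `∫ ‖R‖ dμ ≤ ½`
(display (11.4)), then `z ≠ 0`. -/
theorem ne_zero_of_representation {z c : ℂ} {R : Ω → ℂ} (hc : c ≠ 0) (hR : Integrable R μ)
    (hsmall : ∫ ω, ‖R ω‖ ∂μ ≤ 1 / 2) (hz : z = c * ∫ ω, (1 + R ω) ∂μ) : z ≠ 0 := by
  rw [hz]
  exact mul_ne_zero hc (integral_one_add_ne_zero hR (by linarith))

end Summit.HubbardSuperconductivity.HubbardSuperconductivity.Theorems.ComplexGFF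

end
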